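import Mathlib.RingTheory.Norm.Basic
import Mathlib.LinearAlgebra.Determinant
import Mathlib.LinearAlgebra.Matrix.Block
import Mathlib.LinearAlgebra.FreeModule.Finite.Basic
import HarnessLib

/-!
# The algebra norm of a DEPENDENT product of finite free algebras: `N_{(Π_i A_i)/R}(x) = ∏_i N_{A_i/R}(x_i)`

`Literature/RingTheory/Norm` support file (everything proved, no definitions), companion of `MatrixAlgebra.lean` (`algebraNorm_pi_apply`: the
CONSTANT-fibre case `Π_i B`, via Mathlib's `LinearMap.det_pi`).  For a finite family of `R`-algebras `A_i`, each finite free over the commutative ring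
`R`, the regular representation of `Π_i A_i` is block diagonal with blocks of DIFFERENT sizes:
* `det_blockDiagonal'_eq_prod` — `det (blockDiagonal' d) = ∏_k det d_k` (Mathlib's `Matrix.det_blockDiagonal` is the equal-size case; proof by
  block-triangularity along an enumeration of the index, as in the tree's private copies in `AlgebraicGeometry/HodgeTheory/WeilClassesField*`);
* `toMatrix_pi_eq_blockDiagonal'`, `det_pi_eq_prod` — `det (⊕_i f_i) = ∏_i det f_i` for endomorphisms `f_i` of finite free modules `M_i`;
* `lmul_pi_eq` — multiplication by `x` on `Π_i A_i` is `⊕_i (x_i ·)`; ★ **`algebraNorm_piFamily_apply`** — `Algebra.norm R x = ∏_i Algebra.norm R (x i)`.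
Use (cell `bsd-print-cf2`, brick §4(c) dictionary D2): the semi-local norm `N_{K_v ⊗ F'/K_v ⊗ F}` read at a place `w ∣ v` of `F` is the norm of the
`F_w`-algebra `∏_{w'∣w} F'_{w'}`, i.e. the PRODUCT of the local norms `N_{F'_{w'}/F_w}` (Cassels–Fröhlich II §11).  The trace analogue is the tree's
`Literature.RingTheory.Etale.trace_pi_apply`.

## References
* N. Bourbaki, *Algebra I*, III §9 no. 3 (norm of the regular representation; products). [BourbakiAlgebraI1989]
* R. A. Horn, C. R. Johnson, *Matrix Analysis*, 2nd ed. (2013), §0.9.2 (block diagonal matrices). [HornJohnson2013]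
-/

noncomputable section

namespace Literature.RingTheory.Norm

open Module

/-! ### Determinant of a block diagonal matrix with blocks of different sizes -/

/-- **`det (blockDiagonal' d) = ∏_k det d_k`** for square blocks of different sizes (Mathlib's `Matrix.det_blockDiagonal` is the equal-size case):
the matrix is block triangular along an enumeration of the block index. [cite: HornJohnson2013, §0.9.2] -/
theorem det_blockDiagonal'_eq_prod {R : Type*} [CommRing R] {κ : Type*} [Fintype κ] [DecidableEq κ]
    {σ : κ → Type*} [∀ k, Fintype (σ k)] [∀ k, DecidableEq (σ k)] (d : ∀ k, Matrix (σ k) (σ k) R) :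
    (Matrix.blockDiagonal' d).det = ∏ k, (d k).det := by
  let e := Fintype.equivFin κ
  have hT : (Matrix.blockDiagonal' d).BlockTriangular (fun a : Σ j, σ j => e a.1) := by
    rintro ⟨i, x⟩ ⟨j, y⟩ h
    exact Matrix.blockDiagonal'_apply_ne d x y fun hij => absurd (congrArg (⇑e) hij.symm) (ne_of_lt h)
  rw [hT.det_fintype]
  refine (Fintype.prod_equiv e (fun k => (d k).det) _ fun k => ?_).symm
  let f₀ : σ k ≃ {a : Σ j, σ j // a.1 = k} :=
    { toFun := fun x => ⟨⟨k, x⟩, rfl⟩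
      invFun := fun a => a.2 ▸ a.1.2
      left_inv := fun _ => rfl
      right_inv := by
        rintro ⟨⟨j, x⟩, h⟩
        subst h
        rfl }
  let f : σ k ≃ {a : Σ j, σ j // e a.1 = e k} := f₀.trans (Equiv.subtypeEquivRight fun a => e.injective.eq_iff.symm)
  rw [Matrix.toSquareBlock_def, ← Matrix.det_submatrix_equiv_self f]
  congr 1
  ext x y
  simp only [Matrix.submatrix_apply]
  exact (Matrix.blockDiagonal'_apply_eq d k x y).symm

/-! ### `det (⊕_i f_i) = ∏_i det f_i` on a dependent product of finite free modules -/

section DetPi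

variable {R : Type*} [CommRing R] {ι : Type*} [Fintype ι] [DecidableEq ι] {M : ι → Type*} [∀ i, AddCommGroup (M i)] [∀ i, Module R (M i)]

/-- In the product basis, `⊕_i f_i` has the block diagonal matrix `blockDiagonal' (toMatrix b_i b_i f_i)`. [cite: HornJohnson2013, §0.9.2] -/
theorem toMatrix_pi_eq_blockDiagonal' {σ : ι → Type*} [∀ i, Fintype (σ i)] [∀ i, DecidableEq (σ i)] (b : ∀ i, Basis (σ i) R (M i))
    (f : ∀ i, M i →ₗ[R] M i) :
    LinearMap.toMatrix (Pi.basis b) (Pi.basis b) (LinearMap.pi fun i => (f i).comp (LinearMap.proj i)) =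
      Matrix.blockDiagonal' fun i => LinearMap.toMatrix (b i) (b i) (f i) := by
  ext ⟨s, i⟩ ⟨s', j⟩
  rw [LinearMap.toMatrix_apply, Pi.basis_apply, Pi.basis_repr]
  simp only [LinearMap.pi_apply, LinearMap.comp_apply, LinearMap.proj_apply]
  by_cases h : s = s'
  · subst h
    rw [Matrix.blockDiagonal'_apply_eq, Pi.single_eq_same, LinearMap.toMatrix_apply]
  · rw [Matrix.blockDiagonal'_apply_ne _ _ _ h, Pi.single_eq_of_ne h, map_zero, map_zero, Finsupp.zero_apply]

/-- **`det (⊕_i f_i) = ∏_i det f_i`** for endomorphisms of finite free modules of different ranks (Mathlib's `LinearMap.det_pi` is the constant-fibre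
case). [cite: HornJohnson2013, §0.9.2] -/
theorem det_pi_eq_prod [∀ i, Module.Free R (M i)] [∀ i, Module.Finite R (M i)] (f : ∀ i, M i →ₗ[R] M i) :
    LinearMap.det (LinearMap.pi fun i => (f i).comp (LinearMap.proj i) : Module.End R (Π i, M i)) = ∏ i, LinearMap.det (f i) := by
  classical
  let b := fun i => Module.Free.chooseBasis R (M i)
  rw [← LinearMap.det_toMatrix (Pi.basis b), toMatrix_pi_eq_blockDiagonal', det_blockDiagonal'_eq_prod]
  exact Finset.prod_congr rfl fun i _ => LinearMap.det_toMatrix _ _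

end DetPi

/-! ### The norm of a dependent product algebra -/

section NormPi

variable {R : Type*} [CommRing R] {ι : Type*} [Fintype ι] {A : ι → Type*} [∀ i, Ring (A i)] [∀ i, Algebra R (A i)]

omit [Fintype ι] in
/-- Multiplication by `x` on the product algebra `Π_i A_i` is `⊕_i (x_i ·)`. [cite: BourbakiAlgebraI1989, III §9 no. 3] -/
theorem lmul_pi_eq (x : Π i, A i) :
    (Algebra.lmul R (Π i, A i) x : Module.End R (Π i, A i)) =
      LinearMap.pi fun i => (Algebra.lmul R (A i) (x i) : Module.End R (A i)).comp (LinearMap.proj i) :=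
  LinearMap.ext fun _ => funext fun _ => rfl

/-- ★ **`N_{(Π_i A_i)/R}(x) = ∏_i N_{A_i/R}(x_i)`** for a finite family of finite free `R`-algebras `A_i` (the regular representation of the product is
block diagonal). [cite: BourbakiAlgebraI1989, III §9 no. 3] -/
theorem algebraNorm_piFamily_apply [∀ i, Module.Free R (A i)] [∀ i, Module.Finite R (A i)] (x : Π i, A i) :
    Algebra.norm R x = ∏ i, Algebra.norm R (x i) := by
  classical
  rw [Algebra.norm_apply, lmul_pi_eq, det_pi_eq_prod]
  exact Finset.prod_congr rfl fun i _ => (Algebra.norm_apply R (x i)).symm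

end NormPi

end Literature.RingTheory.Norm

end
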